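import Summits.BirchSwinnertonDyer.BirchSwinnertonDyer.Theorems.BiquadraticEisensteinDescentHeegnerTwistCouplingInSupplyQuarticPlusDescentDual
import Summits.BirchSwinnertonDyer.BirchSwinnertonDyer.Theorems.BiquadraticEisensteinDescentHeegnerTwistCouplingInSupplyQuarticPartnerCorner
import HarnessLib

set_option linter.dupNamespace false -- `Summit.BirchSwinnertonDyer.BirchSwinnertonDyer.Theorems.…` (summit = sub)
set_option autoImplicit false

/-!
# Crux `HeegnerTwistCouplingInSupply` (stmt-BirchSwinnertonDyer-21381) — the quartic `j = 1728` corner, habitat H⁺ (`y² = x³ + p·x`), III: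
# ★★ `p ≡ 15 (mod 16)` with partner `5` (all `p ≡ ±2 (mod 5)`), and the generic partner rung `(r/p) = −1`

Route `BiquadraticEisensteinDescent` (cell `pub/bsd-wall`, width seat `bsd-wall-cm-bed-w4` g13; `--supports` 21381, helper). The second
quartic habitat `W_p⁺ : y² = x³ + p·x`, `p ≡ 15 (mod 16)` (odd `2`-Selmer parity; `p ≡ 3 (mod 16)` needs partners `r ≡ 1 (mod 8)`, untreated):

* §1 family: `W_p⁺^{(d)} = ⟨0, ↑0, 0, ↑(d²p), 0⟩`, `ℤ`-model `⟨0,0,0,p,0⟩` (`Δ = −64p³`), good reduction away from `2p`, `N`-support `{2, p}`;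
* §2 `rank_sha_corank_plus`, `L_one_ne_zero_plus`: for `q ≡ 3 (mod 8)` with `(q/p) = +1` and a partner `r ≡ 5 (mod 8)` with `(r/p) = −1`,
  `E = W_p⁺^{(−rq)} : y² = x³ + r²pq²x` has rank `0`, `Ш[2] = 0`, `corank_{ℤ₂} Sel_{2^∞} = 0` (UNCONDITIONAL; `…QuarticPlusDescent/Dual`) and,
  modulo Burungale–Tian + Deuring–Hecke, `L(E, 1) ≠ 0`;
* §3 ★★ `cruxOnQuarticPlusCornerFive_of_two_facts`: EVERY prime `p ≡ 15 (mod 16)` with `p ≡ ±2 (mod 5)`: a Heegner field `K′ = ℚ(√−5q)` of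
  `N(W_p⁺)` with `4 < |d|`, `L(W_p⁺^{(d)}, 1) ≠ 0`, `h(K′) < p`, `p ∤ h(K′)` — modulo `hBT` + `hH` only (supply = cell A of the `E_{2p}` corner,
  `exists_threePlus_classNumber_lt`, all `p ≥ 7`); ★★ `cruxOnQuarticPlusCornerPartner_of_two_facts`: the generic rung — any partner prime
  `r ≡ 5 (mod 8)` with `(r/p) = −1`, `p ≥ max(800, P)` where `8⁸(10r)⁵ ≤ (2.718·3.1415)⁸P³` (pin `indefinitePinThreePlus`: `q ≤ 10p`).

The law here is `(r/p) = −1` (density `1/2` per partner; no fourth powers: `(p/r) = −1` makes the reduced forms at `r` anisotropic outright),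
vs. H⁻'s `p ∈ 𝔽_r^{×2} ∖ 𝔽_r^{×4}`. HONEST FRAMING: typed sub-corner rungs on one CM family (measure zero in «all CM `W`»); the crux (residual
C⁺) is untouched; 21381 is NOT closed by corner theorems; BSD is not proved by any of this. THEOREMS ONLY. Supports stmt-BirchSwinnertonDyer-21381.
-/

noncomputable section

open scoped Classical NumberField

namespace Summit.BirchSwinnertonDyer.BirchSwinnertonDyer.Theorems.BiquadraticEisensteinDescentHeegnerTwistCouplingInSupplyQuarticPlusCorner

open _root_.WeierstrassCurve Literature.NumberTheory.EllipticCurves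
open IsDedekindDomain Rat.HeightOneSpectrum
open Summit.BirchSwinnertonDyer.BirchSwinnertonDyer.Theorems.BiquadraticEisensteinDescentHeegnerTwistCouplingInSupplyQuarticTwistLocal
open Summit.BirchSwinnertonDyer.BirchSwinnertonDyer.Theorems.BiquadraticEisensteinDescentHeegnerTwistCouplingInSupplyQuarticTwistCorner
open Summit.BirchSwinnertonDyer.BirchSwinnertonDyer.Theorems.BiquadraticEisensteinDescentHeegnerTwistCouplingInSupplyQuarticPlusDescent
open Summit.BirchSwinnertonDyer.BirchSwinnertonDyer.Theorems.BiquadraticEisensteinDescentHeegnerTwistCouplingInSupplyQuarticPlusDescentDual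
open Summit.BirchSwinnertonDyer.BirchSwinnertonDyer.Theorems.BiquadraticEisensteinDescentHeegnerTwistCouplingInSupplyQuarticPartnerCorner
open Summit.BirchSwinnertonDyer.BirchSwinnertonDyer.Theorems.BiquadraticEisensteinDescentHeegnerTwistCouplingInSupplyPartnerLadder
open Summit.BirchSwinnertonDyer.BirchSwinnertonDyer.Theorems.BiquadraticEisensteinDescentHeegnerTwistCouplingInSupplyIndefinitePin
open Summit.BirchSwinnertonDyer.BirchSwinnertonDyer.Theorems.BiquadraticEisensteinDescentHeegnerTwistCouplingInSupplyIndefinitePinWitness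

/-! ## §1 The family `W_p⁺ : y² = x³ + p·x` -/

section Family

/-- Twisting: `(y² = x³ + px)^{(d)} = (y² = x³ + d²p·x)`, in the literal of the descent files. [cite: SilvermanAEC2009, X.2 and X.5] -/
theorem quadraticTwist_Wplus (p : ℕ) (d : ℤ) :
    (⟨0, 0, 0, (p : ℚ), 0⟩ : WeierstrassCurve ℚ).quadraticTwist (d : ℚ) = ⟨0, ((0 : ℤ) : ℚ), 0, ((d ^ 2 * p : ℤ) : ℚ), 0⟩ := by
  rw [quadraticTwist_mk]; ext <;> push_cast <;> ring

/-- The `ℤ`-model `⟨0, 0, 0, p, 0⟩` maps to `W_p⁺`. [folklore] -/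
theorem map_WplusInt (p : ℕ) :
    (⟨0, 0, 0, (p : ℤ), 0⟩ : WeierstrassCurve ℤ).map (Int.castRingHom ℚ) = ⟨0, 0, 0, (p : ℚ), 0⟩ := by
  ext <;> simp [WeierstrassCurve.map]

/-- `Δ(⟨0, 0, 0, p, 0⟩) = −64p³`. [cite: SilvermanAEC2009, III.1 (b₂, b₄, b₆, b₈, Δ)] -/
theorem WplusInt_Δ (p : ℕ) : (⟨0, 0, 0, (p : ℤ), 0⟩ : WeierstrassCurve ℤ).Δ = -64 * (p : ℤ) ^ 3 := by
  simp only [WeierstrassCurve.Δ, WeierstrassCurve.b₂, WeierstrassCurve.b₄, WeierstrassCurve.b₆, WeierstrassCurve.b₈]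
  ring

/-- A prime `r ∤ 2p` does not divide `Δ = −64p³`. [folklore] -/
theorem not_dvd_WplusInt_Δ {p r : ℕ} (hr : r.Prime) (hrp : ¬ r ∣ 2 * p) :
    ¬ (r : ℤ) ∣ (⟨0, 0, 0, (p : ℤ), 0⟩ : WeierstrassCurve ℤ).Δ := by
  rw [WplusInt_Δ]
  intro h
  have h' : (r : ℤ) ∣ 64 * (p : ℤ) ^ 3 := by
    have := h.neg_right
    rwa [show -(-64 * (p : ℤ) ^ 3) = 64 * (p : ℤ) ^ 3 by ring] at this
  have h'' : r ∣ 64 * p ^ 3 := by exact_mod_cast h'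
  rcases (Nat.Prime.dvd_mul hr).mp h'' with h64 | hp3
  · exact hrp ((hr.dvd_of_dvd_pow (show r ∣ 2 ^ 6 by simpa using h64)).mul_right p)
  · exact hrp ((hr.dvd_of_dvd_pow hp3).mul_left 2)

/-- **`W_p⁺` has good reduction at every prime `r ∤ 2p`.** [cite: SilvermanAEC2009, VII.5 Prop. 5.1(a)] -/
theorem hasGoodReductionAtPrime_Wplus {p r : ℕ} [Fact r.Prime] (hrp : ¬ r ∣ 2 * p) :
    (⟨0, 0, 0, (p : ℚ), 0⟩ : WeierstrassCurve ℚ).HasGoodReductionAtPrime r := by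
  obtain ⟨v, rfl⟩ : ∃ v : HeightOneSpectrum (𝓞 ℚ), (primesEquiv v : ℕ) = r :=
    ⟨primesEquiv.symm ⟨r, Fact.out⟩, by rw [Equiv.apply_symm_apply]⟩
  rw [← map_WplusInt]
  exact (hasGoodReductionAtPrime_iff_hasGoodReductionAt_ringOfIntegers v _).2
    (hasGoodReductionAt_map_of_not_dvd _ v (not_dvd_WplusInt_Δ Fact.out hrp))

/-- **Every prime divisor of `N(W_p⁺)` is `2` or `p`.** [cite: SilvermanATAEC1994, Thm. IV.10.2(a)] -/
theorem eq_two_or_eq_of_prime_dvd_conductorNorm_Wplus {p r : ℕ} [(⟨0, 0, 0, (p : ℚ), 0⟩ : WeierstrassCurve ℚ).IsElliptic]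
    (hp : p.Prime) (hr : r.Prime) (h : r ∣ (⟨0, 0, 0, (p : ℚ), 0⟩ : WeierstrassCurve ℚ).conductorNorm ℤ) :
    r = 2 ∨ r = p := by
  by_contra hne
  push Not at hne
  have hrp : ¬ r ∣ 2 * p := fun hd => by
    rcases (Nat.Prime.dvd_mul hr).mp hd with h2 | hp'
    · exact hne.1 ((Nat.prime_dvd_prime_iff_eq hr Nat.prime_two).mp h2)
    · exact hne.2 ((Nat.prime_dvd_prime_iff_eq hr hp).mp hp')
  haveI : Fact r.Prime := ⟨hr⟩
  exact not_dvd_conductorNorm_of_hasGoodReductionAtPrime _ (hasGoodReductionAtPrime_Wplus hrp) h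

end Family

/-! ## §2 The twist `E = W_p⁺^{(−rq)} : y² = x³ + r²pq²·x` -/

section Twist

variable {p q r : ℕ} [hp : Fact p.Prime] [hq : Fact q.Prime] [hr : Fact r.Prime]

/-- ★ **`rank = 0`, `Ш[2] = 0`, `corank_{ℤ₂} Sel_{2^∞} = 0` for `E : y² = x³ + r²pq²·x`** under the H⁺ hypotheses — UNCONDITIONAL.
[cite: SilvermanAEC2009, Prop. X.4.7 and Thm. X.4.2(a); Prop. X.6.1] [cite: Greenberg1999LNM, §1 pp. 54–57] -/
theorem rank_sha_corank_plus (hp16 : p % 16 = 15) (hq8 : q % 8 = 3) (hr8 : r % 8 = 5)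
    (hsq : IsSquare ((q : ℤ) : ZMod p)) (hnr : ¬ IsSquare ((r : ℤ) : ZMod p))
    [hE : (⟨0, ((0 : ℤ) : ℚ), 0, ((r ^ 2 * p * q ^ 2 : ℤ) : ℚ), 0⟩ : WeierstrassCurve ℚ).IsElliptic] :
    (⟨0, ((0 : ℤ) : ℚ), 0, ((r ^ 2 * p * q ^ 2 : ℤ) : ℚ), 0⟩ : WeierstrassCurve ℚ).mordellWeilRank = 0 ∧
    (∀ c ∈ (⟨0, ((0 : ℤ) : ℚ), 0, ((r ^ 2 * p * q ^ 2 : ℤ) : ℚ), 0⟩ : WeierstrassCurve ℚ).sha, 2 • c = 0 → c = 0) ∧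
    (⟨0, ((0 : ℤ) : ℚ), 0, ((r ^ 2 * p * q ^ 2 : ℤ) : ℚ), 0⟩ : WeierstrassCurve ℚ).selmerCorank 2 = 0 := by
  have hP := hp.out
  have hp0 : (p : ℤ) ≠ 0 := by exact_mod_cast hP.ne_zero
  have hq0 : (q : ℤ) ≠ 0 := by exact_mod_cast hq.out.ne_zero
  have hr0 : (r : ℤ) ≠ 0 := by exact_mod_cast hr.out.ne_zero
  have hb : (r ^ 2 * p * q ^ 2 : ℤ) ≠ 0 := mul_ne_zero (mul_ne_zero (pow_ne_zero 2 hr0) hp0) (pow_ne_zero 2 hq0)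
  have hab : (r ^ 2 * p * q ^ 2 : ℤ) * ((0 : ℤ) ^ 2 - 4 * (r ^ 2 * p * q ^ 2 : ℤ)) ≠ 0 := by
    refine mul_ne_zero hb ?_
    rw [show ((0 : ℤ) ^ 2 - 4 * (r ^ 2 * p * q ^ 2 : ℤ)) = -(4 * (r ^ 2 * p * q ^ 2)) by ring]
    exact neg_ne_zero.mpr (mul_ne_zero (by norm_num) hb)
  haveI := isElliptic_halfModel hab
  have h1p : (1 : ℤ) ≠ (p : ℤ) := by exact_mod_cast hP.one_lt.ne
  have h1p' : (1 : ℤ) ≠ -(p : ℤ) := by have := hP.one_lt; omega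
  have hS : twoIsogenySelmerGroup 0 (r ^ 2 * p * q ^ 2 : ℤ) = {1, (p : ℤ)} := by
    ext d; rw [mem_selmer_pos_iff_plus hp16 hq8 hr8 hsq hnr, Finset.mem_insert, Finset.mem_singleton]
  have hS' : twoIsogenySelmerGroup' 0 (r ^ 2 * p * q ^ 2 : ℤ) = {1, -(p : ℤ)} := by
    rw [twoIsogenySelmerGroup'_eq, show (-2 * 0 : ℤ) = 0 by norm_num,
      show ((0 : ℤ) ^ 2 - 4 * (r ^ 2 * p * q ^ 2 : ℤ)) = -(4 * r ^ 2 * p * q ^ 2) by ring]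
    ext d; rw [mem_selmer_neg_iff_plus hp16 hq8 hr8 hsq hnr, Finset.mem_insert, Finset.mem_singleton]
  have h1 : twoIsogenySelmerRank 0 (r ^ 2 * p * q ^ 2 : ℤ) = 1 := by
    rw [twoIsogenySelmerRank, hS, Finset.card_pair h1p]; exact Nat.log_pow Nat.one_lt_two 1
  have h2 : twoIsogenySelmerRank' 0 (r ^ 2 * p * q ^ 2 : ℤ) = 1 := by
    rw [twoIsogenySelmerRank'_eq, hS', Finset.card_pair h1p']; exact Nat.log_pow Nat.one_lt_two 1
  have hle : twoIsogenySelmerRank 0 (r ^ 2 * p * q ^ 2 : ℤ) + twoIsogenySelmerRank' 0 (r ^ 2 * p * q ^ 2 : ℤ) ≤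
      (⟨0, ((0 : ℤ) : ℚ), 0, ((r ^ 2 * p * q ^ 2 : ℤ) : ℚ), 0⟩ : WeierstrassCurve ℚ).mordellWeilRank + 2 := by
    rw [h1, h2]; omega
  obtain ⟨-, -, hsum⟩ := natCard_sha_inf_range_eq_one_of_selmerRank_add_le hab hle
  have hrank : (⟨0, ((0 : ℤ) : ℚ), 0, ((r ^ 2 * p * q ^ 2 : ℤ) : ℚ), 0⟩ : WeierstrassCurve ℚ).mordellWeilRank = 0 := by
    rw [h1, h2] at hsum; omega
  have hsha := forall_mem_sha_two_smul_eq_zero_of_selmerRank_add_le hab hle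
  haveI : Fact (Nat.Prime 2) := ⟨Nat.prime_two⟩
  refine ⟨hrank, hsha, ?_⟩
  rw [(⟨0, ((0 : ℤ) : ℚ), 0, ((r ^ 2 * p * q ^ 2 : ℤ) : ℚ), 0⟩ : WeierstrassCurve ℚ).selmerCorank_eq_mordellWeilRank_add_holds 2,
    hrank, (⟨0, ((0 : ℤ) : ℚ), 0, ((r ^ 2 * p * q ^ 2 : ℤ) : ℚ), 0⟩ : WeierstrassCurve ℚ).shaCorank_eq_zero_of_forall 2 hsha]

/-- ★ `r_an(E) = 0` and `L(E, 1) ≠ 0` for `E : y² = x³ + r²pq²·x` under the H⁺ hypotheses, modulo Burungale–Tian and Deuring–Hecke.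
[cite: BurungaleTian2026, Thm. 1.1] [cite: SilvermanATAEC1994, Ch. II Cor. 10.5.1] -/
theorem L_one_ne_zero_plus (hBT : burungaleTian_analyticRank_eq_zero_of_selmerCorank_eq_zero_of_hasCM)
    (hH : hasEntireLFunction_of_j_mem_maximalCMJInvariants) (hp16 : p % 16 = 15) (hq8 : q % 8 = 3) (hr8 : r % 8 = 5)
    (hsq : IsSquare ((q : ℤ) : ZMod p)) (hnr : ¬ IsSquare ((r : ℤ) : ZMod p))
    [hE : (⟨0, ((0 : ℤ) : ℚ), 0, ((r ^ 2 * p * q ^ 2 : ℤ) : ℚ), 0⟩ : WeierstrassCurve ℚ).IsElliptic] :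
    (⟨0, ((0 : ℤ) : ℚ), 0, ((r ^ 2 * p * q ^ 2 : ℤ) : ℚ), 0⟩ : WeierstrassCurve ℚ).analyticRank = 0 ∧
    (⟨0, ((0 : ℤ) : ℚ), 0, ((r ^ 2 * p * q ^ 2 : ℤ) : ℚ), 0⟩ : WeierstrassCurve ℚ).entireLFunction 1 ≠ 0 := by
  haveI : Fact (Nat.Prime 2) := ⟨Nat.prime_two⟩
  have hb : (r ^ 2 * p * q ^ 2 : ℤ) ≠ 0 := mul_ne_zero (mul_ne_zero (pow_ne_zero 2 (by exact_mod_cast hr.out.ne_zero))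
    (by exact_mod_cast hp.out.ne_zero)) (pow_ne_zero 2 (by exact_mod_cast hq.out.ne_zero))
  obtain ⟨hj, hCM⟩ := j_and_hasCM_lit hb
  obtain ⟨-, -, hcor⟩ := rank_sha_corank_plus hp16 hq8 hr8 hsq hnr
  have h0 := hBT _ hCM 2 hcor
  refine ⟨h0, (analyticRank_eq_zero_iff_holds (W := (⟨0, ((0 : ℤ) : ℚ), 0, ((r ^ 2 * p * q ^ 2 : ℤ) : ℚ), 0⟩ :
    WeierstrassCurve ℚ)) (hH _ ?_)).1 h0⟩
  rw [hj]
  simp [maximalCMJInvariants]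

end Twist

/-! ## §3 ★★ The corners -/

section Corner

/-- From `jacobiSym a p = 1` (`p` prime): `a` is a residue mod `p` and `p ∤ a`. [folklore] -/
theorem isSquare_of_jacobiSym_eq_one {p a : ℕ} [hp : Fact p.Prime] (h : jacobiSym (a : ℤ) p = 1) : IsSquare ((a : ℤ) : ZMod p) := by
  have ha0 : ((a : ℤ) : ZMod p) ≠ 0 := by
    intro h0
    rw [← jacobiSym.legendreSym.to_jacobiSym, legendreSym.eq_zero_iff p (a : ℤ) |>.mpr h0] at h
    exact zero_ne_one h
  rw [← legendreSym.eq_one_iff p ha0, jacobiSym.legendreSym.to_jacobiSym]; exact h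

/-- From `jacobiSym a p = −1` (`p` prime): `a` is a non-residue mod `p`. [folklore] -/
theorem not_isSquare_of_jacobiSym_eq_neg_one {p a : ℕ} [hp : Fact p.Prime] (h : jacobiSym (a : ℤ) p = -1) :
    ¬ IsSquare ((a : ℤ) : ZMod p) := by
  rw [← legendreSym.eq_neg_one_iff p, jacobiSym.legendreSym.to_jacobiSym]; exact h

/-- The common final step: from the cell data `(q, r)` to the `L`-value of the twist by `−qr`. [folklore] -/
theorem L_twist_ne_zero_plus (hBT : burungaleTian_analyticRank_eq_zero_of_selmerCorank_eq_zero_of_hasCM)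
    (hH : hasEntireLFunction_of_j_mem_maximalCMJInvariants) {p q r : ℕ} (hp : p.Prime) (hq : q.Prime) (hr : r.Prime)
    (hp16 : p % 16 = 15) (hq8 : q % 8 = 3) (hr8 : r % 8 = 5)
    (hsq : haveI := Fact.mk hp; IsSquare ((q : ℤ) : ZMod p)) (hnr : haveI := Fact.mk hp; ¬ IsSquare ((r : ℤ) : ZMod p)) :
    ((⟨0, 0, 0, (p : ℚ), 0⟩ : WeierstrassCurve ℚ).quadraticTwist ((-((q * r : ℕ) : ℤ) : ℤ) : ℚ)).entireLFunction 1 ≠ 0 := by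
  haveI := Fact.mk hp; haveI := Fact.mk hq; haveI := Fact.mk hr
  rw [quadraticTwist_Wplus]
  rw [show ((-((q * r : ℕ) : ℤ)) ^ 2 * p : ℤ) = (r ^ 2 * p * q ^ 2 : ℤ) by push_cast; ring]
  have hb : (r ^ 2 * p * q ^ 2 : ℤ) ≠ 0 := mul_ne_zero (mul_ne_zero (pow_ne_zero 2 (by exact_mod_cast hr.ne_zero))
    (by exact_mod_cast hp.ne_zero)) (pow_ne_zero 2 (by exact_mod_cast hq.ne_zero))
  have hab : (r ^ 2 * p * q ^ 2 : ℤ) * ((0 : ℤ) ^ 2 - 4 * (r ^ 2 * p * q ^ 2 : ℤ)) ≠ 0 := by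
    refine mul_ne_zero hb ?_
    rw [show ((0 : ℤ) ^ 2 - 4 * (r ^ 2 * p * q ^ 2 : ℤ)) = -(4 * (r ^ 2 * p * q ^ 2)) by ring]
    exact neg_ne_zero.mpr (mul_ne_zero (by norm_num) hb)
  haveI := isElliptic_mk_of_ne_zero (F := ℚ) hab
  exact (L_one_ne_zero_plus hBT hH hp16 hq8 hr8 hsq hnr).2

/-- ★★ **H⁺ CORNER, PARTNER `5`: every prime `p ≡ 15 (mod 16)` with `p ≡ ±2 (mod 5)`.** A Heegner field `K′ = ℚ(√−5q)` of `N(W_p⁺)`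
(`q ≡ 3 (8)`, `(q/p) = +1`, `h(−5q) < p`: cell A of the `E_{2p}` corner, `exists_threePlus_classNumber_lt`, all `p ≥ 7`) with `4 < |d|`,
`L(W_p⁺^{(d)}, 1) ≠ 0`, `h(K′) < p`, `p ∤ h(K′)` — modulo Burungale–Tian + Deuring–Hecke ONLY. [cite: BurungaleTian2026, Thm. 1.1]
[cite: SilvermanAEC2009, Prop. X.4.9, Prop. X.4.7, Thm. X.4.2(a)] [cite: Oesterle1988Gauss, II §3 Proposition p. 57 (27)] -/
theorem cruxOnQuarticPlusCornerFive_of_two_facts (hBT : burungaleTian_analyticRank_eq_zero_of_selmerCorank_eq_zero_of_hasCM)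
    (hH : hasEntireLFunction_of_j_mem_maximalCMJInvariants) :
    ∀ (p : ℕ) [Fact p.Prime] [(⟨0, 0, 0, (p : ℚ), 0⟩ : WeierstrassCurve ℚ).IsElliptic]
      [(⟨0, 0, 0, (p : ℚ), 0⟩ : WeierstrassCurve ℚ).IsGloballyMinimal]
      [NeZero ((⟨0, 0, 0, (p : ℚ), 0⟩ : WeierstrassCurve ℚ).conductorNorm ℤ)],
      p % 16 = 15 → (p % 5 = 2 ∨ p % 5 = 3) →
      ∃ (K : Type) (_ : Field K) (_ : NumberField K),
        IsImaginaryQuadratic K ∧ 4 < (NumberField.discr K).natAbs ∧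
        SatisfiesHeegnerHypothesis ((⟨0, 0, 0, (p : ℚ), 0⟩ : WeierstrassCurve ℚ).conductorNorm ℤ) K ∧
        ((⟨0, 0, 0, (p : ℚ), 0⟩ : WeierstrassCurve ℚ).quadraticTwist (NumberField.discr K : ℚ)).entireLFunction 1 ≠ 0 ∧
        NumberField.classNumber K < p ∧ ¬ p ∣ NumberField.classNumber K := by
  intro p hpF _ _ _ hp16 hp5
  have hp : p.Prime := hpF.out
  have hp4 : p % 4 = 3 := by omega
  obtain ⟨q, hq, hq8, hJq, hh⟩ := exists_threePlus_classNumber_lt hp hp4 hp5 (by omega)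
  have hsq : IsSquare ((q : ℤ) : ZMod p) := isSquare_of_jacobiSym_eq_one hJq
  have hnr : ¬ IsSquare (((5 : ℕ) : ℤ) : ZMod p) :=
    not_isSquare_of_jacobiSym_eq_neg_one (by exact_mod_cast jacobiSym_five_eq_neg_one (p := p) (by omega) hp5)
  have hJ := jacobiSym_neg_five_mul_cellA hp4 hp5 hJq
  obtain ⟨K, iF, iN, hK, hdK, hH', hcl⟩ := exists_witnessField_five_of
    (N := (⟨0, 0, 0, (p : ℚ), 0⟩ : WeierstrassCurve ℚ).conductorNorm ℤ) hq hq8 hJ hh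
    (fun s hs hsN => eq_two_or_eq_of_prime_dvd_conductorNorm_Wplus hp hs hsN)
  refine ⟨K, iF, iN, hK, ?_, hH', ?_, hcl, fun hdvd =>
    absurd (Nat.le_of_dvd (NumberField.classNumber_pos K) hdvd) (not_le.mpr hcl)⟩
  · rw [hdK, Int.natAbs_neg, Int.natAbs_natCast]
    have := hq.two_le
    omega
  · rw [hdK, show (5 * q : ℕ) = q * 5 from Nat.mul_comm 5 q]
    exact L_twist_ne_zero_plus hBT hH hp hq Nat.prime_five hp16 hq8 (by norm_num) hsq hnr

/-- ★★ **H⁺ GENERIC PARTNER RUNG**: for a partner prime `r ≡ 5 (mod 8)` and a threshold `P` with `8⁸(10r)⁵ ≤ (2.718·3.1415)⁸P³`: for every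
prime `p ≡ 15 (mod 16)`, `p ≥ 800`, `p ≥ P`, with `(r/p) = −1`, a Heegner field `K′ = ℚ(√−qr)` of `N(W_p⁺)` (`q ≤ 10p` the indefinite pin,
`q ≡ 3 (8)`, `(q/p) = +1`) with `4 < |d|`, `L(W_p⁺^{(d)}, 1) ≠ 0`, `h(K′) < p`, `p ∤ h(K′)` — modulo `hBT` + `hH` only.
[cite: BurungaleTian2026, Thm. 1.1] [cite: Oesterle1988Gauss, II §3 Proposition p. 57 (27)] -/
theorem cruxOnQuarticPlusCornerPartner_of_two_facts (hBT : burungaleTian_analyticRank_eq_zero_of_selmerCorank_eq_zero_of_hasCM)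
    (hH : hasEntireLFunction_of_j_mem_maximalCMJInvariants) {r : ℕ} (hr : r.Prime) (hr8 : r % 8 = 5) {P : ℕ}
    (hkey : (8 : ℝ) ^ 8 * ((10 * r : ℕ) : ℝ) ^ 5 ≤ (2.718 * 3.1415) ^ 8 * (P : ℝ) ^ 3) :
    ∀ (p : ℕ) [Fact p.Prime] [(⟨0, 0, 0, (p : ℚ), 0⟩ : WeierstrassCurve ℚ).IsElliptic]
      [(⟨0, 0, 0, (p : ℚ), 0⟩ : WeierstrassCurve ℚ).IsGloballyMinimal]
      [NeZero ((⟨0, 0, 0, (p : ℚ), 0⟩ : WeierstrassCurve ℚ).conductorNorm ℤ)],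
      p % 16 = 15 → 800 ≤ p → P ≤ p → ¬ IsSquare ((r : ℤ) : ZMod p) →
      ∃ (K : Type) (_ : Field K) (_ : NumberField K),
        IsImaginaryQuadratic K ∧ 4 < (NumberField.discr K).natAbs ∧
        SatisfiesHeegnerHypothesis ((⟨0, 0, 0, (p : ℚ), 0⟩ : WeierstrassCurve ℚ).conductorNorm ℤ) K ∧
        ((⟨0, 0, 0, (p : ℚ), 0⟩ : WeierstrassCurve ℚ).quadraticTwist (NumberField.discr K : ℚ)).entireLFunction 1 ≠ 0 ∧
        NumberField.classNumber K < p ∧ ¬ p ∣ NumberField.classNumber K := by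
  intro p hpF _ _ _ hp16 h800 hPp hnr
  have hp : p.Prime := hpF.out
  have hp4 : p % 4 = 3 := by omega
  haveI : Fact r.Prime := ⟨hr⟩
  obtain ⟨q, hq, hq8, hJq, hqle⟩ := indefinitePinThreePlus hp hp4 h800
  have hsq : IsSquare ((q : ℤ) : ZMod p) := isSquare_of_jacobiSym_eq_one hJq
  have hJr : jacobiSym (r : ℤ) p = -1 := by
    rw [← jacobiSym.legendreSym.to_jacobiSym, legendreSym.eq_neg_one_iff p]; exact hnr
  have hJ : jacobiSym (-((q * r : ℕ) : ℤ)) p = 1 := jacobiSym_neg_mul_eq_one hp4 hJq hJr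
  have hxc : ((q * r : ℕ) : ℝ) < ((10 * r : ℕ) : ℝ) * p := by
    have hqlt : q < 10 * p := by
      rcases hqle.lt_or_eq with h | h
      · exact h
      · exfalso; omega
    have h1 : q * r < 10 * r * p := by have := hr.pos; nlinarith
    exact_mod_cast h1
  have hh := classNumber_lt_of_lever hq hr hr8 hxc hkey hPp
  obtain ⟨K, iF, iN, hK, hdK, hH', hcl⟩ := exists_witnessField_of
    (N := (⟨0, 0, 0, (p : ℚ), 0⟩ : WeierstrassCurve ℚ).conductorNorm ℤ) hq hq8 hr hr8 hJ hh
    (fun s hs hsN => eq_two_or_eq_of_prime_dvd_conductorNorm_Wplus hp hs hsN)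
  refine ⟨K, iF, iN, hK, ?_, hH', ?_, hcl, fun hdvd =>
    absurd (Nat.le_of_dvd (NumberField.classNumber_pos K) hdvd) (not_le.mpr hcl)⟩
  · rw [hdK, Int.natAbs_neg, Int.natAbs_natCast]
    have := hq.two_le
    have : 5 ≤ r := by have := hr.two_le; omega
    nlinarith
  · rw [hdK]
    exact L_twist_ne_zero_plus hBT hH hp hq hr hp16 hq8 hr8 hsq hnr

end Corner

end Summit.BirchSwinnertonDyer.BirchSwinnertonDyer.Theorems.BiquadraticEisensteinDescentHeegnerTwistCouplingInSupplyQuarticPlusCorner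

end
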